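import Literature.NumberTheory.Automorphic.CDTTheorem722
import Literature.NumberTheory.Automorphic.CDTTheorem722Proofs
import Literature.NumberTheory.Automorphic.CDTTheorem722ThreeFactsProofs
import Literature.NumberTheory.Automorphic.CDTTheorem712
import Literature.NumberTheory.Automorphic.BCDTModularityModPProofs
import Literature.NumberTheory.EllipticCurves.CuspFormLFunctionLevelConductorProofs
import Literature.NumberTheory.EllipticCurves.CuspFormLFunctionLevelConductorOfCarayolProofs
import Literature.NumberTheory.EllipticCurves.EisensteinNewformLevelRaising
import Literature.NumberTheory.EllipticCurves.NewformGaloisRepEulerFactors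
import Literature.NumberTheory.EllipticCurves.Szpiro
import HarnessLib

/-!
# Stub ideation k=2 (gen 2) for `stub_threeImpTwo` (crux `FreyModularity`, stmt-ABC-11340) — helper
lemma SIGNATURES (elaboration sanity only; bodies `sorry`), companion of
`STUB-IDEAS-stub_threeImpTwo-2.md`.

RESHAPE (family 2): (T2) weaken-and-bootstrap at TORSION level via Deligne's compatible system
(`Hida2000_thm326_exists_galoisRep`) — the `p = ℓ` hole of the lead's rejected candidate S10 (c41)
is closed at an AUXILIARY prime `p'` (Diamond–Shurman Prop. 9.6.4 / Ex. 9.6.2), not by `p`-adic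
Hodge theory; (T1) split-into-regimes at the level: `v_q(N) = f_q(E)` is Carayol-free at every
non-additive place, so Carayol's conductor theorem is needed at additive places only.
-/

noncomputable section

open scoped NumberField Polynomial MatrixGroups ModularForm
open NumberField IsDedekindDomain IsDedekindDomain.HeightOneSpectrum Polynomial
open CongruenceSubgroup Rat.HeightOneSpectrum
open Literature.NumberTheory.EllipticCurves
open Literature.NumberTheory.EllipticCurves.ModularForms
open Literature.NumberTheory.Automorphic
open Literature.NumberTheory.Automorphic.BCDT
open Literature.NumberTheory.GaloisRepresentations
open WeierstrassCurve

attribute [local instance] AddSubgroup.torsionBy.zmodModule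

namespace Summit.ABC.ABC.Cruxes.FreyModularity.Sketch.StubIdeasThreeImpTwo2G2

/-- The registered stub S9, verbatim. -/
def SigStubThreeImpTwo : Prop :=
  ∀ (W : WeierstrassCurve ℚ) [W.IsElliptic] [NeZero (W.conductorNorm ℤ)] (ℓ : ℕ) [Fact ℓ.Prime],
    W.IsModularGaloisRepTate ℓ → BCDT.IsModular W

/-- h32F — S9 restricted to Frey curves (instances I1, I3 of `isModular_freyCurve_of_stubs`). -/
def SigThreeImpTwoFrey : Prop :=
  ∀ (a b : ℤ), IsCoprime a b → a * b * (a + b) ≠ 0 →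
    ∀ [(freyCurve a b).IsElliptic] [NeZero ((freyCurve a b).conductorNorm ℤ)] (ℓ : ℕ) [Fact ℓ.Prime],
      (freyCurve a b).IsModularGaloisRepTate ℓ → BCDT.IsModular (freyCurve a b)

/-- h32T — S9 at TORSION level for the switched curve `W'` (instance I2): `ρ_{W',3}` modular ⇒ every
framed model of `W'[5]` is modular.  This is the lead's candidate S10 (NOTES c41). -/
def SigThreeImpTwoTorsion : Prop :=
  ∀ (W : WeierstrassCurve ℚ) [W.IsElliptic], W.IsModularGaloisRepTate 3 →
    ∀ (ρ : ModPGaloisRep ℚ (ZMod 5) 2), W.IsTorsionGaloisRep 5 ρ → ρ.IsModular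

/-! ## T2 — torsion-level bootstrap through the compatible system -/

/-- **A (hole closer, hD).**  For the newform `f₀ ∈ S₂(Γ₀(N))` carrying the packet `a_p(f₀) = a_p(E)`
off a finite set `T₀` (from `IsModularGaloisRepTate ℓ`: ideator-1 H1 / tree
`exists_isNewform0_cuspCoeff_eq_lFunction_of_isModularGaloisRepTate`), EVERY prime `q ∤ N` is a prime
of good reduction with `a_q(f₀) = a_q(E)` — in particular `q = ℓ`.  Proof: auxiliary prime `p' ≠ q`,
Deligne's `ρ_g` at `p'` is `V_{p'}(E) ⊗ ℚ̄_{p'}` (ideator-1 `H2_exists_isGaloisRepOfNewform1_equiv`,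
PROVED from `hD`); `ρ_g` is unramified at `q ∤ N p'` with `charpoly(Frob_q) = ι⁻¹(X² − a_q(f₀)X + q)`
(`IsGaloisRepOfNewform1`); transport (`isUnramifiedAt_of_equiv`, `hasFrobCharpolyAt_of_equiv`,
`FramedGaloisRep.isUnramifiedAt_baseChange_iff`), Néron–Ogg–Shafarevich for `V_{p'}`
(`hasGoodReductionAt_iff_forall_rationalGaloisRepTate_eq_one`, `neronOggShafarevich_holds`) and
`exists_framedGaloisRep_rationalTate` (charpoly `X² − a_q(E) X + q` at good `q ≠ p'`).
Diamond–Shurman Ex. 9.6.2. -/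
theorem hasGoodReductionAt_and_cuspCoeff_eq_of_deligne (hD : Hida2000_thm326_exists_galoisRep)
    (W : WeierstrassCurve ℚ) [W.IsElliptic] {N : ℕ} [NeZero N] {f₀ : CuspForm (Gamma0 N) 2}
    (hf₀ : IsNewform0 f₀) {T₀ : ℕ} (hT₀ : T₀ ≠ 0)
    (hfp : ∀ p : ℕ, p.Prime → ¬ p ∣ T₀ → cuspCoeff f₀ p = (W.LFunction p : ℂ))
    (v : HeightOneSpectrum (𝓞 ℚ)) (hv : ¬ ((primesEquiv v : ℕ) ∣ N)) :
    W.HasGoodReductionAt v ∧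
      cuspCoeff f₀ (primesEquiv v : ℕ) = (W.LFunction (primesEquiv v : ℕ) : ℂ) := by
  sorry

/-- **D (same prime, UNCONDITIONAL).**  `ρ_{E,ℓ}` modular ⇒ every framed model of `E[ℓ]` is modular:
the packet off `N ℓ` (H1: good reduction AND `a_p(f₀) = a_p(E)` for `p ∤ N ℓ`) is exactly what
`isModular_of_isNewform0_packet` consumes, the curve side being
`IsTorsionGaloisRep.isUnramifiedAt_of_hasGoodReductionAt` / `….charpoly_eq_of_isArithFrobAt`
(`trace_galoisRepTate_frobenius_of_hasGoodReductionAt_holds`, Weil pairing), as in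
`IsModular.exists_isNewform0_packet`.  No hole: the exceptional sets coincide. -/
theorem isModular_of_isTorsionGaloisRep_of_isModularGaloisRepTate_self
    (W : WeierstrassCurve ℚ) [W.IsElliptic] (ℓ : ℕ) [Fact ℓ.Prime] (h : W.IsModularGaloisRepTate ℓ)
    {ρ : ModPGaloisRep ℚ (ZMod ℓ) 2} (hρ : W.IsTorsionGaloisRep ℓ ρ) : ρ.IsModular := by
  sorry

/-- **B (any prime, hD) — the lead's S10 made provable.**  `ρ_{E,ℓ'}` modular ⇒ every framed model of
`E[ℓ]` is modular, for every `ℓ`: D with the packet extended across `p = ℓ'` by A (taking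
`T₀ = N ℓ'`), i.e. the packet holds off `N` and hence off `N ℓ`.  Diamond–Shurman Prop. 9.6.4. -/
theorem isModular_of_isTorsionGaloisRep_of_isModularGaloisRepTate
    (hD : Hida2000_thm326_exists_galoisRep)
    (W : WeierstrassCurve ℚ) [W.IsElliptic] (ℓ' : ℕ) [Fact ℓ'.Prime] (h : W.IsModularGaloisRepTate ℓ')
    (ℓ : ℕ) [Fact ℓ.Prime] {ρ : ModPGaloisRep ℚ (ZMod ℓ) 2} (hρ : W.IsTorsionGaloisRep ℓ ρ) :
    ρ.IsModular := by
  sorry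

/-- **C (ℓ-switch, hD; optional).**  `ρ_{E,ℓ'}` modular ⇒ `ρ_{E,ℓ}` modular for every `ℓ`
(Diamond–Shurman Prop. 9.6.4 via Ex. 9.6.2: same newform, the Tate-module clause at `p ∤ N ℓ` from
good reduction + `a_p(f₀) = a_p(E)` off `N` (A), through `galoisRepTate_eq_one_of_mem_inertia` and
`map_charpoly_galoisRepTate_eq`, as in the tree's (2) ⇒ (4)). -/
theorem isModularGaloisRepTate_of_isModularGaloisRepTate (hD : Hida2000_thm326_exists_galoisRep)
    (W : WeierstrassCurve ℚ) [W.IsElliptic] (ℓ' ℓ : ℕ) [Fact ℓ'.Prime] [Fact ℓ.Prime]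
    (h : W.IsModularGaloisRepTate ℓ') : W.IsModularGaloisRepTate ℓ := by
  sorry

/-- h32T from B (`ℓ' = 3`, `ℓ = 5`). -/
theorem sigThreeImpTwoTorsion_of_deligne (hD : Hida2000_thm326_exists_galoisRep) :
    SigThreeImpTwoTorsion :=
  fun W _ h _ρ hρ ↦ isModular_of_isTorsionGaloisRep_of_isModularGaloisRepTate hD W 3 h 5 hρ

/-- h32T is WEAKER than S9 (sanity: the recut loses nothing). -/
theorem sigThreeImpTwoTorsion_of_stub (h32 : SigStubThreeImpTwo) : SigThreeImpTwoTorsion := by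
  intro W _ h ρ hρ
  haveI : NeZero (W.conductorNorm ℤ) := ⟨(conductorNorm_pos_holds W).ne'⟩
  exact (h32 W 3 h).isModular_of_isTorsionGaloisRep'' hρ

/-- h32F is WEAKER than S9. -/
theorem sigThreeImpTwoFrey_of_stub (h32 : SigStubThreeImpTwo) : SigThreeImpTwoFrey :=
  fun a b _ _ _ _ ℓ _ h ↦ h32 (freyCurve a b) ℓ h

/-! ## T1 — the level, split into regimes: Carayol-free off the additive places -/

section Level

variable {N : ℕ} [NeZero N] {W : WeierstrassCurve ℚ} [W.IsElliptic] {f : CuspForm (Gamma0 N) 2}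

/-- **E (L1, Carayol-free).**  At a NON-additive place `w ∋ q` of `E`: `v_q(N) = f_w(E)` (`∈ {0,1}`),
from the `q`-expansion alone: good ⇒ `q ∤ N` (`IsNewformOf.dvd_level_iff_dvd_conductorNorm`) and
`f_w = 0` (`conductorExponent_eq_zero_iff_holds`); multiplicative ⇒ `q ∣ N`, `a_q(E) = ±1 ≠ 0`
(`LFunction_apply_primesEquiv_of_hasSplitMultiplicativeReductionAt` / `…_of_not_split`) ⇒ `q² ∤ N`
(`IsNewformOf.not_sq_dvd_level_of_lFunction_ne_zero`, Atkin–Lehner Thm. 3) and `f_w = 1`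
(`conductorExponent_eq_one_iff_holds`, `conductorExponent_ringOfIntegers_eq`). -/
theorem IsNewformOf.padicValNat_level_eq_conductorExponent_of_not_hasAdditiveReductionAt
    (hf : IsNewformOf W f) {q : ℕ} (hq : q.Prime) (w : HeightOneSpectrum (𝓞 ℚ))
    (hqw : (q : 𝓞 ℚ) ∈ w.asIdeal) (hna : ¬ W.HasAdditiveReductionAt w) :
    padicValNat q N = W.conductorExponent w := by
  sorry

/-- **E' (L2, Carayol-free).**  At an ADDITIVE place `w ∋ q`: `2 ≤ v_q(N)` (and `2 ≤ f_w`,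
`two_le_conductorExponent_iff_holds`): `q ∣ N` and `a_q(f) = a_q(E) = 0`
(`LFunction_apply_primesEquiv_of_hasAdditiveReductionAt`), while `q ∥ N` would force `a_q(f)² = 1`
— Atkin–Lehner 1970 Thm 3(iii) `a_q = −λ_q`, which is NOT in the tree (only the converse
`IsNewform0.cuspCoeff_eq_zero_of_sq_dvd` is): OPTIONAL, not used by F below; cite AL or skip. -/
theorem IsNewformOf.two_le_padicValNat_level_of_hasAdditiveReductionAt
    (hf : IsNewformOf W f) {q : ℕ} (hq : q.Prime) (w : HeightOneSpectrum (𝓞 ℚ))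
    (hqw : (q : 𝓞 ℚ) ∈ w.asIdeal) (ha : W.HasAdditiveReductionAt w) :
    2 ≤ padicValNat q N := by
  sorry

/-- **F (L3).**  `N = N_E` as soon as the exponents match at the ADDITIVE places (E elsewhere;
assembly as `eq_conductorNorm_of_forall_padicValNat_eq_conductorExponent` — `private` in the Carayol
file, public copy `…'` in ideator-2 gen-1 `STUB_IDEAS_stub_threeImpTwo_2.lean`). -/
theorem IsNewformOf.level_eq_conductorNorm_of_additiveMatch (hf : IsNewformOf W f)
    (hadd : ∀ (q : ℕ) (w : HeightOneSpectrum (𝓞 ℚ)), q.Prime → (q : 𝓞 ℚ) ∈ w.asIdeal →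
      W.HasAdditiveReductionAt w → padicValNat q N = W.conductorExponent w) :
    N = W.conductorNorm ℤ := by
  sorry

/-- **F-Frey.**  For a Frey curve only the place over `2` can be additive
(`isSemistableAt_freyCurve_holds`, `hasAdditiveReductionAt_int_iff_ringOfIntegers`): `N = N_E` as
soon as `v₂(N) = f₂(E)` in the additive-at-`2` classes. -/
theorem IsNewformOf.level_eq_conductorNorm_freyCurve {a b : ℤ} (hab : IsCoprime a b)
    (h0 : a * b * (a + b) ≠ 0) [(freyCurve a b).IsElliptic] {f : CuspForm (Gamma0 N) 2}
    (hf : IsNewformOf (freyCurve a b) f)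
    (h2 : ∀ w : HeightOneSpectrum (𝓞 ℚ), (2 : 𝓞 ℚ) ∈ w.asIdeal →
      (freyCurve a b).HasAdditiveReductionAt w → padicValNat 2 N = (freyCurve a b).conductorExponent w) :
    N = (freyCurve a b).conductorNorm ℤ := by
  sorry

end Level

/-! ## Assembly -/

/-- **SomeLevel** — `ρ_{E,ℓ}` modular ⇒ `IsNewformOf E f₀` at SOME level: the common output of
ideator-1's PROVED core `exists_isNewformOf_of_isModularGaloisRepTate_of_deligne_of_carayolEuler hD hCE`
and of the Eichler–Shimura road (`hES` + Faltings + `IsIsogenous.LFunction_eq`, the first 15 lines of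
`isModular_of_isModularGaloisRepTate_of_facts`, before `hC` is touched); = gen-1 k2 `SomeLevel`. -/
def SomeLevel : Prop :=
  ∀ (W : WeierstrassCurve ℚ) [W.IsElliptic] [NeZero (W.conductorNorm ℤ)] (ℓ : ℕ) [Fact ℓ.Prime],
    W.IsModularGaloisRepTate ℓ →
      ∃ (N : ℕ) (_ : NeZero N) (f : CuspForm (Gamma0 N) 2), IsNewformOf W f

/-- **G₀ (PROVED modulo F)** — the verbatim stub from SomeLevel and the additive exponent match. -/
theorem threeImpTwo_of_someLevel_of_additiveMatch (hSome : SomeLevel)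
    (hAM : ∀ (N : ℕ) [NeZero N] (W : WeierstrassCurve ℚ) [W.IsElliptic] (f : CuspForm (Gamma0 N) 2),
      IsNewformOf W f → ∀ (q : ℕ) (w : HeightOneSpectrum (𝓞 ℚ)), q.Prime → (q : 𝓞 ℚ) ∈ w.asIdeal →
        W.HasAdditiveReductionAt w → padicValNat q N = W.conductorExponent w) :
    SigStubThreeImpTwo := by
  intro W _ _ ℓ _ h
  obtain ⟨N, hN, f, hf⟩ := hSome W ℓ h
  have hNW : N = W.conductorNorm ℤ :=
    IsNewformOf.level_eq_conductorNorm_of_additiveMatch hf (hAM N W f hf)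
  subst hNW
  exact ⟨f, hf⟩

/-- **G₀-Frey (PROVED modulo F-Frey)** — h32F from SomeLevel and the match at the place over `2`. -/
theorem sigThreeImpTwoFrey_of_someLevel_of_freyAdditiveMatch (hSome : SomeLevel)
    (hAM₂ : ∀ (a b : ℤ), IsCoprime a b → a * b * (a + b) ≠ 0 → ∀ [(freyCurve a b).IsElliptic]
      (N : ℕ) [NeZero N] (f : CuspForm (Gamma0 N) 2), IsNewformOf (freyCurve a b) f →
      ∀ w : HeightOneSpectrum (𝓞 ℚ), (2 : 𝓞 ℚ) ∈ w.asIdeal → (freyCurve a b).HasAdditiveReductionAt w →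
        padicValNat 2 N = (freyCurve a b).conductorExponent w) :
    SigThreeImpTwoFrey := by
  intro a b hab h0 _ _ ℓ _ h
  obtain ⟨N, hN, f, hf⟩ := hSome (freyCurve a b) ℓ h
  have hNW : N = (freyCurve a b).conductorNorm ℤ :=
    IsNewformOf.level_eq_conductorNorm_freyCurve hab h0 hf (hAM₂ a b hab h0 N f hf)
  subst hNW
  exact ⟨f, hf⟩


/-- **G — conditional closer of the VERBATIM stub**: Deligne (`hD`) + Carayol's Euler factors
(`hCE`) give `IsNewformOf E f₀` at SOME level (ideator-1's PROVED
`exists_isNewformOf_of_isModularGaloisRepTate_of_deligne_of_carayolEuler`); F pins the level from the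
exponent match at ADDITIVE places only (`hAM`, = Carayol's conductor theorem + Ogg–Saito there —
strictly less than the skeleton's `IsNewformOf.level_eq_conductorNorm` / `hC` everywhere). -/
theorem threeImpTwo_of_deligne_of_carayolEuler_of_additiveMatch
    (hD : Hida2000_thm326_exists_galoisRep) (hCE : Carayol1986_eulerFactor)
    (hAM : ∀ (N : ℕ) [NeZero N] (W : WeierstrassCurve ℚ) [W.IsElliptic] (f : CuspForm (Gamma0 N) 2),
      IsNewformOf W f → ∀ (q : ℕ) (w : HeightOneSpectrum (𝓞 ℚ)), q.Prime → (q : 𝓞 ℚ) ∈ w.asIdeal →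
        W.HasAdditiveReductionAt w → padicValNat q N = W.conductorExponent w) :
    SigStubThreeImpTwo := by
  sorry

/-- **G-Frey — closer of h32F**: the same with the additive match needed at the place over `2` of
FREY curves only (`hAM₂`; vacuous in the classes not additive at `2`, e.g. `16 ∣ ab(a+b)` suitably
signed — there `N_E` is squarefree and ideator-1's `…_of_squarefree` already closes). -/
theorem sigThreeImpTwoFrey_of_deligne_of_carayolEuler_of_freyAdditiveMatch
    (hD : Hida2000_thm326_exists_galoisRep) (hCE : Carayol1986_eulerFactor)
    (hAM₂ : ∀ (a b : ℤ), IsCoprime a b → a * b * (a + b) ≠ 0 → ∀ [(freyCurve a b).IsElliptic]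
      (N : ℕ) [NeZero N] (f : CuspForm (Gamma0 N) 2), IsNewformOf (freyCurve a b) f →
      ∀ w : HeightOneSpectrum (𝓞 ℚ), (2 : 𝓞 ℚ) ∈ w.asIdeal → (freyCurve a b).HasAdditiveReductionAt w →
        padicValNat 2 N = (freyCurve a b).conductorExponent w) :
    SigThreeImpTwoFrey := by
  sorry

end Summit.ABC.ABC.Cruxes.FreyModularity.Sketch.StubIdeasThreeImpTwo2G2

end
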